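import Summits.MatrixMultiplication.OmegaCensus.SmallFormats.MatMul22nRankGF7Slack4SearchRun1
import Summits.MatrixMultiplication.OmegaCensus.SmallFormats.MatMul22nRankGF7Slack4SearchRun2
import Summits.MatrixMultiplication.OmegaCensus.SmallFormats.MatMul22nRankGF7Slack4SearchRun3
import Summits.MatrixMultiplication.OmegaCensus.SmallFormats.MatMul22nRankGF7Slack4Buckets1
import Summits.MatrixMultiplication.OmegaCensus.SmallFormats.MatMul22nRankGF7Slack4Buckets2
import Summits.MatrixMultiplication.OmegaCensus.SmallFormats.MatMul22nRankGF7Slack4Buckets3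
import Summits.MatrixMultiplication.OmegaCensus.SmallFormats.MatMul22nRankGF7Slack4Buckets4
import Summits.MatrixMultiplication.OmegaCensus.SmallFormats.MatMul22nRankGF7Slack4Buckets5
import Summits.MatrixMultiplication.OmegaCensus.SmallFormats.MatMul22nRankGF7Slack4Buckets6
import Summits.MatrixMultiplication.OmegaCensus.SmallFormats.MatMul22nRankGF7Slack4Buckets7
import Summits.MatrixMultiplication.OmegaCensus.SmallFormats.MatMul22nRankGF7Slack4Buckets8
import Summits.MatrixMultiplication.OmegaCensus.SmallFormats.MatMul22nRankGF7Slack4SearchSound2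
import Summits.MatrixMultiplication.OmegaCensus.SmallFormats.MatMul22nRankGF7ThreeNPlusFiveReduction
import HarnessLib

/-!
# ω-census family (a): `M₇(4) ≤ 207` — no LP-tight point of the slack-4 `𝔽₇` X-cap system; `R_𝔽₇(⟨2,2,n⟩) ≥ 3n + 5` for `n ≥ 68`

Cell `pub-omega` (unit `pub-omega-tensor-g15`), topic `Summits/MatrixMultiplication/OmegaCensus` (sub-folder `SmallFormats`).
Framing (verbatim): lottery ticket; floor = certified bounds/negative ranges. HONEST FRAMING: ONE census cell beyond the `𝔽₇` floor
(`3n + 4` for `n ≥ 51`, `MatMul22nRankGF7Slack3NoTightPoint`; LP floor `⌈52n/17⌉`, `MatMul22nRankGF7LPFloor`): here `3n + 5` for every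
`n ≥ 68` (all orientations), cell `n = 68`: `209 ≤ R_𝔽₇(⟨2,2,68⟩)`. The cell was decided ×2 at ENGINE grade (R292: tensor g14 engines A/B/B′,
referee gen 149); this is its KERNEL form. Nothing here is progress on `ω`.

PROOF (kernel route of `pub-omega-tensor-g15/KERNEL-S4-DESIGN.md`). By `noTightPoint7_4_208_of_reps` (WLOG by left multiplication: torus-`0`
column = one of 120 class representatives) it suffices to refute each representative; `search7_sound` does so from the replayed certificate
(`Slack4SearchRun1–3`: the 22 617-node search dies everywhere; `Slack4Buckets1–6`: every slot with a visited key is in its bucket), using the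
certified mod-7 relations (`Slack4RelData1–4`), the slot decomposition of column patterns (`Slots`) and the dot-product arithmetic (`DotProduct`).
-/

namespace Summit.MatrixMultiplication.OmegaCensus.SmallFormats

open Finset Literature.Computability.AlgebraicComplexity

/-- CHECK A for all 40 320 slots. -/
theorem slotOK7_all : ∀ c < 120, ∀ h < 336, slotOK7 c h = true := by
  intro c hc h hh
  by_cases hb0 : c < 20
  · exact slotOK7_ok_1 (c := c) (by omega) hb0 hh
  by_cases hb1 : c < 40
  · exact slotOK7_ok_2 (c := c) (by omega) hb1 hh
  by_cases hb2 : c < 45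
  · exact slotOK7_ok_3 c (by omega) hb2 h hh
  by_cases hb3 : c < 60
  · exact slotOK7_ok_4 c (by omega) hb3 h hh
  by_cases hb4 : c < 75
  · exact slotOK7_ok_5 c (by omega) hb4 h hh
  by_cases hb5 : c < 90
  · exact slotOK7_ok_6 c (by omega) hb5 h hh
  by_cases hb6 : c < 105
  · exact slotOK7_ok_7 c (by omega) hb6 h hh
  exact slotOK7_ok_8 c (by omega) (by omega) h hh

/-- CHECK B for all 120 classes. -/
theorem search7_all : ∀ c < 120, search7 c = true := by
  intro c hc
  by_cases hr0 : c < 31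
  · exact search7_ok_1 (c := c) (by omega) hr0
  by_cases hr1 : c < 107
  · exact search7_ok_2 (c := c) (by omega) hr1
  exact search7_ok_3 (c := c) (by omega) (by omega)

/-- **`M₇(4) ≤ 207`: the slack-4 `𝔽₇` X-cap system has no point of total `≥ 208`.** -/
theorem noTightPoint7_4_208 : NoTightPoint7 4 208 :=
  noTightPoint7_4_208_of_reps fun c hc x hbox hrows hge hcol => search7_sound slotOK7_all (search7_all c hc) x hbox hrows hge hcol

/-- **`R_𝔽₇(⟨2,2,n⟩) ≥ 3n + 5` for every `n ≥ 68`** (one above the LP floor at `n = 68`; unconditional). -/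
theorem three_mul_add_five_le_tensorRank_matMulTensor_22n_gf7 (n : ℕ) (hn : 68 ≤ n) :
    3 * n + 5 ≤ tensorRank (matMulTensor (ZMod 7) 2 2 n) :=
  three_mul_add_five_le_of_noTightPoint7 noTightPoint7_4_208 n hn

/-- The same for all three orientations `⟨2,2,n⟩`, `⟨2,n,2⟩`, `⟨n,2,2⟩`. -/
theorem three_mul_add_five_le_tensorRank_matMulTensor_gf7_orientations (n : ℕ) (hn : 68 ≤ n) :
    3 * n + 5 ≤ tensorRank (matMulTensor (ZMod 7) 2 2 n) ∧ 3 * n + 5 ≤ tensorRank (matMulTensor (ZMod 7) 2 n 2) ∧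
      3 * n + 5 ≤ tensorRank (matMulTensor (ZMod 7) n 2 2) :=
  three_mul_add_five_le_orientations_of_noTightPoint7 noTightPoint7_4_208 n hn

/-- **The census cell `n = 68`:** `209 ≤ R_𝔽₇(⟨2,2,68⟩)`. -/
theorem tensorRank_matMulTensor_2_2_68_gf7_ge : 209 ≤ tensorRank (matMulTensor (ZMod 7) 2 2 68) :=
  tensorRank_matMulTensor_2_2_68_gf7_ge_of_noTightPoint7 noTightPoint7_4_208

end Summit.MatrixMultiplication.OmegaCensus.SmallFormats
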